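import Literature.AlgebraicGeometry.Resolution.KollarCoverTriples
import Literature.AlgebraicGeometry.Resolution.BlowupSequencesSNC
import Literature.AlgebraicGeometry.Resolution.AlterationsModification
import Literature.AlgebraicGeometry.Resolution.AlterationsLemma411SmoothLocus
import Literature.AlgebraicGeometry.Resolution.SchematicallyDense
import Literature.AlgebraicGeometry.Resolution.StalkIdealLemmas
import Mathlib.AlgebraicGeometry.IdealSheaf.IrreducibleComponent
import Mathlib.AlgebraicGeometry.Morphisms.SchemeTheoreticallyDominant
import HarnessLib

/-!
# The triple at the top of a smooth blow-up (Kollár 2007, Notation 3.64 along Def. 3.66)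

Topic: `Literature/AlgebraicGeometry/Resolution`. Shared infrastructure for the decomposition of
the named facts `Kollar2007Thm3_103` / `Kollar2007Thm3_107` (`KollarBlowupSequenceFunctors.lean`;
J. Kollár, *Lectures on Resolution of Singularities*, 2007, Ch. 3). Kollár's blow-up sequence
functors are applied to triples `(X, I, E)` (Notation 3.64: `X` smooth and equidimensional of
dimension `n`, `I` nonzero on every irreducible component, `E` a simple normal crossing
boundary), and the inductive constructions 3.104 / 3.111 continue on the last blown-up scheme:
"(`X_{i+1}, I_{i+1}, E_{i+1}`) … (`X_r`, `I_r`, `E_r`)" are again triples. This file proves it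
for ONE blow-up `π : Bl_Z X → X` of a triple along a regular centre `Z ⊆ cosupp(I, m)` (`m ≥ 1`)
having simple normal crossings with `E` — the step of Def. 3.66:

* generic points: `Kollar2007.Triple.stalkIdeal_eq_top_of_closure_mem` (at a generic point of an
  irreducible component of `X` the ideal `I` is the unit ideal: the local ring is a field and
  `I_x ≠ 0`), hence admissible centres contain no component and their complements are dense
  (`dense_compl_of_subset_support_marked`);
* `IsEffectiveCartier.dense_compl_support` — the complement of an effective Cartier divisor of a
  locally Noetherian reduced scheme is dense (it is schematically dense,
  `IsEffectiveCartier.isSchemeTheoreticallyDominant_ι`, GW Remark 9.24);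
* `Kollar2007.Triple.isBirational_blowupπ` — **the blow-up of a triple along an admissible
  centre is birational** (an isomorphism over the dense complement of the centre, Stacks 02OS,
  with dense preimage, the complement of the exceptional divisor);
* `Kollar2007.Triple.isRegular_blowup` (Liu 8.1.19 (a), `IsBlowup.isRegular_of_isRegular_subscheme`),
  `isIntegral_preimage_and_dim` (the part of the blow-up over an irreducible component `Z` of
  `X` — the preimage of the integral open subscheme on `Z`, `Scheme.irreducibleComponentOpen` —
  is integral of dimension `n`: it is a modification of `Z`, de Jong 2.20
  `IsBirational.isAlteration` / `IsAlteration.topologicalKrullDim_eq`),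
  `exists_eq_preimage_of_mem_irreducibleComponents_blowup` (the irreducible components of the
  blow-up are the preimages of those of `X`), **`equidim_blowup`** (the blow-up is
  equidimensional of dimension `n`), **`stalkIdeal_controlledTransform_ne_bot`** (the transformed
  ideal has no vanishing stalk: the total transform is nonzero on each integral part, being the
  unit ideal over generic points), and the summary `transform_conditions` (with
  `MarkedIdeal.hasSNC_transform_boundary` for the boundary, Def. 3.25).

What is NOT here: that distinct non-empty members of the boundary stay distinct after the
transform (the field `boundary_pairwise` of `Kollar2007.Triple`), and the packaging of the data
as a `Kollar2007.Triple` along a whole sequence — the follow-up file.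

## Sources

* J. Kollár, *Lectures on Resolution of Singularities* (2007): Notation 3.19 (p. 123), Def. 3.25
  (p. 126), Notation 3.64, Def. 3.66 (pp. 148–149). [Kollar2007]
* U. Görtz, T. Wedhorn, *Algebraic Geometry I*, 2nd ed. (2020), Remark 9.24, Prop. 13.91.
  [GortzWedhorn2020]
* A. J. de Jong, *Smoothness, semi-stability and alterations*, Publ. Math. IHÉS 83 (1996), 2.20 —
  through `AlterationsModification.lean` / `AlterationsDimension.lean`. [DeJong1996]
* The Stacks Project, Tag 02OS. [StacksProject]
-/

noncomputable section

open CategoryTheory CategoryTheory.Limits AlgebraicGeometry TopologicalSpace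

namespace Literature.AlgebraicGeometry.Resolution

universe u

/-! ## Effective Cartier divisors are nowhere dense -/

/-- **The complement of an effective Cartier divisor on a locally Noetherian scheme is dense**:
the inclusion of the complement is schematically dominant (GW Remark 9.24,
`IsEffectiveCartier.isSchemeTheoreticallyDominant_ι`) and quasi-compact, hence dominant.
[cite: GortzWedhorn2020, Remark 9.24] -/
theorem IsEffectiveCartier.dense_compl_support {X : Scheme.{u}} [IsLocallyNoetherian X]
    {J : X.IdealSheafData} (hJ : IsEffectiveCartier J) : Dense ((J.support : Set X)ᶜ) := by
  set U : X.Opens := ⟨(J.support : Set X)ᶜ, J.support.isClosed.isOpen_compl⟩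
  haveI : IsSchemeTheoreticallyDominant U.ι := hJ.isSchemeTheoreticallyDominant_ι
  have h : IsDominant U.ι := inferInstance
  have := h.denseRange
  rwa [DenseRange, Scheme.Opens.range_ι] at this

/-- The generic point of an irreducible component lies on it. [folklore] -/
theorem genericPoint_mem_of_mem_irreducibleComponents {X : Scheme.{u}} {Z : Set X}
    (hZ : Z ∈ irreducibleComponents X) : hZ.1.genericPoint ∈ Z := by
  have h1 := hZ.1.closure_genericPoint (isClosed_of_mem_irreducibleComponents Z hZ)
  have : hZ.1.genericPoint ∈ closure ({hZ.1.genericPoint} : Set X) := subset_closure rfl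
  rwa [h1] at this

/-- The closure of the generic point of an irreducible component is that component. [folklore] -/
theorem closure_genericPoint_mem_irreducibleComponents {X : Scheme.{u}} {Z : Set X}
    (hZ : Z ∈ irreducibleComponents X) :
    closure ({hZ.1.genericPoint} : Set X) ∈ irreducibleComponents X := by
  rw [hZ.1.closure_genericPoint (isClosed_of_mem_irreducibleComponents Z hZ)]
  exact hZ

namespace Kollar2007.Triple

variable {k : Type u} [Field k] {n : ℕ}

/-! ## Noetherianity, reducedness -/

/-- The scheme of a triple is Noetherian (of finite type over a field). [folklore] -/
instance isNoetherian (T : Triple k n) : IsNoetherian T.X := by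
  haveI : CompactSpace T.X := QuasiCompact.compactSpace_of_compactSpace T.struct
  exact {}

/-- The scheme of a triple is reduced (its local rings are regular, hence domains). [folklore] -/
instance isReduced (T : Triple k n) : IsReduced T.X :=
  T.isRegular.isReduced

/-! ## Generic points: the ideal of a triple is the unit ideal at every generic point -/

/-- At a generic point of an irreducible component of `X` the ideal `I` of a triple is the unit
ideal: the local ring there is a field (`X` is reduced) and `I_x ≠ 0` (Notation 3.64: `I` is
nonzero on every irreducible component). [cite: Kollar2007, Notation 3.64 (p. 148)] -/
theorem stalkIdeal_eq_top_of_closure_mem (T : Triple k n) {x : T.X}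
    (hx : closure ({x} : Set T.X) ∈ irreducibleComponents T.X) : stalkIdeal T.ideal x = ⊤ := by
  have hF := isField_stalk_of_closure_mem_irreducibleComponents T.X x hx
  obtain ⟨a, ha, ha0⟩ := (stalkIdeal T.ideal x).ne_bot_iff.mp (T.stalkIdeal_ne_bot x)
  obtain ⟨b, hb⟩ := hF.mul_inv_cancel ha0
  exact Ideal.eq_top_of_isUnit_mem _ ha (IsUnit.of_mul_eq_one b hb)

/-- Hence a generic point of an irreducible component does not lie in `V(I)`. [folklore] -/
theorem not_mem_support_ideal_of_closure_mem (T : Triple k n) {x : T.X}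
    (hx : closure ({x} : Set T.X) ∈ irreducibleComponents T.X) :
    x ∉ (T.ideal.support : Set T.X) := by
  intro h
  rw [SetLike.mem_coe, mem_support_iff_stalkIdeal_le, T.stalkIdeal_eq_top_of_closure_mem hx,
    top_le_iff] at h
  exact (IsLocalRing.maximalIdeal.isMaximal _).ne_top h

/-- Nor in `cosupp(I, m)` for `m ≥ 1`. [folklore] -/
theorem not_mem_support_marked_of_closure_mem (T : Triple k n) {m : ℕ} (hm : 1 ≤ m) {x : T.X}
    (hx : closure ({x} : Set T.X) ∈ irreducibleComponents T.X) : x ∉ (T.marked m).support :=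
  fun h => T.not_mem_support_ideal_of_closure_mem hx
    ((T.marked m).support_subset_support_ideal (by simpa using hm) h)

/-- **The complement of a closed subset of `cosupp(I, m)` (`m ≥ 1`) is dense** — e.g. of an
admissible centre (Def. 3.66: `Z_i ⊆ cosupp(I_i, m)`): it contains the generic point of every
irreducible component. [cite: Kollar2007, Def. 3.66 (p. 149)] -/
theorem dense_compl_of_subset_support_marked (T : Triple k n) {m : ℕ} (hm : 1 ≤ m) {S : Set T.X}
    (hS : S ⊆ (T.marked m).support) (hSc : IsClosed S) : Dense Sᶜ := by
  refine dense_of_forall_inter_nonempty hSc.isOpen_compl fun Z hZ => ?_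
  exact ⟨hZ.1.genericPoint, genericPoint_mem_of_mem_irreducibleComponents hZ, fun h =>
    T.not_mem_support_marked_of_closure_mem hm (closure_genericPoint_mem_irreducibleComponents hZ)
      (hS h)⟩

/-! ## The blow-up of a triple along an admissible centre is birational -/

/-- **The blow-up `π : Bl_Z X → X` of a triple along a centre `Z ⊆ cosupp(I, m)`, `m ≥ 1`, is
birational**: it is an isomorphism over the complement of `Z` (Stacks 02OS,
`IsBlowup.isIso_compl`), which is dense (`dense_compl_of_subset_support_marked`), and the
preimage of that complement — the complement of the exceptional divisor, an effective Cartier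
divisor of the locally Noetherian `Bl_Z X` — is dense. [cite: Kollar2007, Def. 3.66 (p. 149)] -/
theorem isBirational_blowupπ (T : Triple k n) {m : ℕ} (hm : 1 ≤ m) {C : T.X.IdealSheafData}
    (hC : (C.support : Set T.X) ⊆ (T.marked m).support) : IsBirational (blowup.π C) := by
  haveI : IsLocallyNoetherian (blowup C) := CentreSeq.isLocallyNoetherian_blowup C
  refine ⟨⟨(C.support : Set T.X)ᶜ, C.support.isClosed.isOpen_compl⟩,
    T.dense_compl_of_subset_support_marked hm hC C.support.isClosed, ?_,
    (blowup.isBlowup C).isIso_compl⟩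
  have : ((blowup.π C ⁻¹ᵁ ⟨(C.support : Set T.X)ᶜ, C.support.isClosed.isOpen_compl⟩ :
      (blowup C).Opens) : Set (blowup C)) = (((C.comap (blowup.π C)).support : Set (blowup C)))ᶜ := by
    rw [Scheme.IdealSheafData.support_comap]
    rfl
  rw [this]
  exact (blowup.isBlowup C).isEffectiveCartier.dense_compl_support

/-! ## The blow-up of a triple: regularity, components, dimension -/

section Blowup

variable (T : Triple k n) {m : ℕ} {C : T.X.IdealSheafData}

/-- The blow-up of a triple along a regular centre is regular (Liu Thm. 8.1.19 (a); Kollár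
Notation 3.19: smooth blow-ups of smooth varieties are smooth). [cite: Kollar2007, Notation 3.19 (p. 123)] -/
theorem isRegular_blowup (hCreg : Scheme.IsRegular C.subscheme) : Scheme.IsRegular (blowup C) :=
  (blowup.isBlowup C).isRegular_of_isRegular_subscheme T.isRegular hCreg

/-- The blow-up of a triple is locally Noetherian. [folklore] -/
instance isLocallyNoetherian_blowup : IsLocallyNoetherian (blowup C) :=
  CentreSeq.isLocallyNoetherian_blowup C

/-- **The part of the blow-up over an irreducible component `Z` of `X` is an integral scheme of
dimension `n`**: `π⁻¹(Z) → Z` is proper and birational onto the integral open subscheme on `Z`,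
so `π⁻¹(Z)` (reduced, `Bl_Z X` being regular) is integral and is an alteration of `Z`, of the same
dimension (de Jong 2.20, `IsAlteration.topologicalKrullDim_eq`). [cite: Kollar2007, Notation 3.64 (p. 148)] -/
theorem isIntegral_preimage_and_dim (hm : 1 ≤ m) (hC : (C.support : Set T.X) ⊆ (T.marked m).support)
    (hCreg : Scheme.IsRegular C.subscheme) {Z : Set T.X} (hZ : Z ∈ irreducibleComponents T.X) :
    IsIntegral ((blowup.π C ⁻¹ᵁ T.X.irreducibleComponentOpen Z : (blowup C).Opens) : Scheme.{u}) ∧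
      topologicalKrullDim
        ((blowup.π C ⁻¹ᵁ T.X.irreducibleComponentOpen Z : (blowup C).Opens) : Scheme.{u}) = n := by
  set W : T.X.Opens := T.X.irreducibleComponentOpen Z with hWdef
  have hW : (W : Set T.X) = Z := T.isRegular.coe_irreducibleComponentOpen hZ
  haveI : IsIntegral (W : Scheme.{u}) := isIntegral_of_coe_eq_of_mem_irreducibleComponents W hZ hW
  haveI : IsReduced ((blowup.π C ⁻¹ᵁ W : (blowup C).Opens) : Scheme.{u}) :=
    haveI : IsReduced (blowup C) := (T.isRegular_blowup hCreg).isReduced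
    isReduced_of_isOpenImmersion (blowup.π C ⁻¹ᵁ W).ι
  haveI : IsProper (blowup.π C) := (blowup.isBlowup C).isProper
  have hbir : IsBirational (blowup.π C ∣_ W) := (T.isBirational_blowupπ hm hC).morphismRestrict W
  have halt : IsAlteration (blowup.π C ∣_ W) := hbir.isAlteration
  refine ⟨hbir.isIntegral, ?_⟩
  rw [halt.topologicalKrullDim_eq (W.ι ≫ T.struct)]
  change topologicalKrullDim ((W : T.X.Opens) : Set T.X) = (n : WithBot ℕ∞)
  rw [IsHomeomorph.topologicalKrullDim_eq _ (Homeomorph.setCongr hW).isHomeomorph]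
  exact T.equidim Z hZ

/-- The preimages of two distinct irreducible components of `X` are disjoint (components of the
regular `X` are pairwise disjoint). [folklore] -/
theorem disjoint_preimage_of_ne {Z Z' : Set T.X} (hZ : Z ∈ irreducibleComponents T.X)
    (hZ' : Z' ∈ irreducibleComponents T.X) (hne : Z ≠ Z') {Y : Type*} (f : Y → T.X) :
    Disjoint (f ⁻¹' Z) (f ⁻¹' Z') :=
  Set.disjoint_left.mpr fun y hy hy' =>
    hne (T.isRegular.eq_of_mem_irreducibleComponents (f y) hZ hZ' hy hy')

/-- **The irreducible components of the blow-up of a triple are the preimages of the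
irreducible components of `X`**: these preimages are irreducible (integral open subschemes),
open, pairwise disjoint and cover, so every irreducible (hence connected) component lies in
one of them and, by maximality, equals it. [cite: Kollar2007, Notation 3.64 (p. 148)] -/
theorem exists_eq_preimage_of_mem_irreducibleComponents_blowup (hm : 1 ≤ m)
    (hC : (C.support : Set T.X) ⊆ (T.marked m).support) (hCreg : Scheme.IsRegular C.subscheme)
    {S : Set (blowup C)} (hS : S ∈ irreducibleComponents (blowup C)) :
    ∃ Z ∈ irreducibleComponents T.X, S = blowup.π C ⁻¹' Z := by
  -- the component of `X` under some point of `S`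
  obtain ⟨s, hs⟩ := hS.1.nonempty
  set Z := irreducibleComponent (blowup.π C s) with hZdef
  have hZ : Z ∈ irreducibleComponents T.X := irreducibleComponent_mem_irreducibleComponents _
  refine ⟨Z, hZ, ?_⟩
  -- `π⁻¹ Z` is irreducible
  have hW : ((T.X.irreducibleComponentOpen Z : T.X.Opens) : Set T.X) = Z :=
    T.isRegular.coe_irreducibleComponentOpen hZ
  have hpre : (blowup.π C ⁻¹' Z) =
      ((blowup.π C ⁻¹ᵁ T.X.irreducibleComponentOpen Z : (blowup C).Opens) : Set (blowup C)) := by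
    rw [Scheme.Hom.coe_preimage, hW]
  have hirr : IsIrreducible (blowup.π C ⁻¹' Z) := by
    haveI := (T.isIntegral_preimage_and_dim hm hC hCreg hZ).1
    have := IsIrreducible.image (IrreducibleSpace.isIrreducible_univ _) _
      (blowup.π C ⁻¹ᵁ T.X.irreducibleComponentOpen Z).ι.continuous.continuousOn
    rwa [Set.image_univ, Scheme.Opens.range_ι, ← hpre] at this
  -- `Z` is open and closed, hence so is `π⁻¹ Z`
  have hZopen : IsOpen Z := hW ▸ (T.X.irreducibleComponentOpen Z).isOpen
  have hZclosed : IsClosed Z := isClosed_of_mem_irreducibleComponents Z hZ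
  -- `S ⊆ π⁻¹ Z`: `S` is connected and meets the clopen `π⁻¹ Z`
  have hsub : S ⊆ blowup.π C ⁻¹' Z := by
    by_contra h
    obtain ⟨t, htS, ht⟩ := Set.not_subset.mp h
    obtain ⟨r, -, hr₁, hr₂⟩ := hS.1.isConnected.isPreconnected (blowup.π C ⁻¹' Z)
      (blowup.π C ⁻¹' Z)ᶜ (hZopen.preimage (blowup.π C).continuous)
      ((hZclosed.preimage (blowup.π C).continuous).isOpen_compl) (by simp)
      ⟨s, hs, mem_irreducibleComponent⟩ ⟨t, htS, ht⟩
    exact hr₂ hr₁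
  exact (Set.Subset.antisymm hsub (hS.2 hirr hsub))

/-- **The blow-up of a triple along an admissible centre is equidimensional of dimension `n`.**
[cite: Kollar2007, Notation 3.64 (p. 148) with Def. 3.66 (p. 149)] -/
theorem equidim_blowup (hm : 1 ≤ m) (hC : (C.support : Set T.X) ⊆ (T.marked m).support)
    (hCreg : Scheme.IsRegular C.subscheme) :
    ∀ S ∈ irreducibleComponents (blowup C), topologicalKrullDim S = n := by
  intro S hS
  obtain ⟨Z, hZ, rfl⟩ := T.exists_eq_preimage_of_mem_irreducibleComponents_blowup hm hC hCreg hS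
  have hW : ((T.X.irreducibleComponentOpen Z : T.X.Opens) : Set T.X) = Z :=
    T.isRegular.coe_irreducibleComponentOpen hZ
  have hpre : (blowup.π C ⁻¹' Z) =
      ((blowup.π C ⁻¹ᵁ T.X.irreducibleComponentOpen Z : (blowup C).Opens) : Set (blowup C)) := by
    rw [Scheme.Hom.coe_preimage, hW]
  rw [IsHomeomorph.topologicalKrullDim_eq _ (Homeomorph.setCongr hpre).isHomeomorph]
  exact (T.isIntegral_preimage_and_dim hm hC hCreg hZ).2

/-- Every point of the blow-up lies in the (integral, open) preimage of the irreducible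
component of `X` through its image. [folklore] -/
theorem mem_preimage_irreducibleComponentOpen (x : blowup C) :
    x ∈ (blowup.π C ⁻¹ᵁ T.X.irreducibleComponentOpen (irreducibleComponent (blowup.π C x)) :
      (blowup C).Opens) := by
  show blowup.π C x ∈ ((T.X.irreducibleComponentOpen _ : T.X.Opens) : Set T.X)
  rw [T.isRegular.coe_irreducibleComponentOpen (irreducibleComponent_mem_irreducibleComponents _)]
  exact mem_irreducibleComponent

/-- The generic point of an irreducible component of `X` is in the image of the blow-up along
an admissible centre (the blow-up is an isomorphism over the complement of the centre, which
contains the generic points). [folklore] -/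
theorem genericPoint_mem_range_blowupπ (hm : 1 ≤ m)
    (hC : (C.support : Set T.X) ⊆ (T.marked m).support) {Z : Set T.X}
    (hZ : Z ∈ irreducibleComponents T.X) : hZ.1.genericPoint ∈ Set.range (blowup.π C) := by
  have hη : hZ.1.genericPoint ∉ (C.support : Set T.X) := fun h =>
    T.not_mem_support_marked_of_closure_mem hm
      (closure_genericPoint_mem_irreducibleComponents hZ) (hC h)
  set U : T.X.Opens := ⟨(C.support : Set T.X)ᶜ, C.support.isClosed.isOpen_compl⟩
  haveI : IsIso (blowup.π C ∣_ U) := (blowup.isBlowup C).isIso_compl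
  obtain ⟨y, hy⟩ := (blowup.π C ∣_ U).surjective ⟨hZ.1.genericPoint, hη⟩
  refine ⟨y.1, ?_⟩
  have := congrArg Subtype.val hy
  simpa only [morphismRestrict_base_coe] using this

/-- **The transformed ideal is nonzero at every point of the blow-up** (Notation 3.64 (2) for
`(X_{i+1}, I_{i+1})`): on the integral open part `π⁻¹(Z)` over the component `Z` of `X` through
the image of the point, the total transform `π^*I` is a nonzero ideal sheaf (it is the unit
ideal over the generic point of `Z`), hence has nonzero stalks; and `I_{i+1} ⊇ π^*I`.
[cite: Kollar2007, Notation 3.64 (2) (p. 148)] -/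
theorem stalkIdeal_controlledTransform_ne_bot (hm : 1 ≤ m)
    (hC : (C.support : Set T.X) ⊆ (T.marked m).support) (hCreg : Scheme.IsRegular C.subscheme)
    (x : blowup C) : stalkIdeal (controlledTransform (blowup.π C) C T.ideal m) x ≠ ⊥ := by
  intro hx
  -- the integral open part over the component through `π x`
  set Z := irreducibleComponent (blowup.π C x) with hZdef
  have hZ : Z ∈ irreducibleComponents T.X := irreducibleComponent_mem_irreducibleComponents _
  set W : T.X.Opens := T.X.irreducibleComponentOpen Z with hWdef
  set W' : (blowup C).Opens := blowup.π C ⁻¹ᵁ W with hW'def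
  haveI : IsIntegral (W' : Scheme.{u}) := (T.isIntegral_preimage_and_dim hm hC hCreg hZ).1
  have hxW' : x ∈ W' := T.mem_preimage_irreducibleComponentOpen x
  -- the total transform restricted to `W'` is a nonzero ideal sheaf
  set K : (W' : Scheme.{u}).IdealSheafData := (T.ideal.comap (blowup.π C)).comap W'.ι with hKdef
  have hK : K ≠ ⊥ := by
    obtain ⟨y, hy⟩ := T.genericPoint_mem_range_blowupπ hm hC hZ
    have hyW' : y ∈ W' := by
      show blowup.π C y ∈ (W : Set T.X)
      rw [hy, T.isRegular.coe_irreducibleComponentOpen hZ]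
      exact genericPoint_mem_of_mem_irreducibleComponents hZ
    intro hK0
    have hmem : (⟨y, hyW'⟩ : W') ∈ K.support := by
      rw [hK0, Scheme.IdealSheafData.support_bot]
      trivial
    rw [hKdef, Scheme.IdealSheafData.support_comap, Scheme.IdealSheafData.support_comap] at hmem
    refine T.not_mem_support_ideal_of_closure_mem
      (closure_genericPoint_mem_irreducibleComponents hZ) ?_
    rw [← hy]
    exact hmem
  -- hence nonzero stalk at `x`, for the total transform and then for the controlled transform
  have h1 : stalkIdeal K ⟨x, hxW'⟩ ≠ ⊥ := stalkIdeal_ne_bot_of_ne_bot hK _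
  apply h1
  rw [hKdef, stalkIdeal_comap_eq_map_stalkMap]
  have h2 : stalkIdeal (T.ideal.comap (blowup.π C)) x = ⊥ := by
    rw [← le_bot_iff, ← hx]
    exact stalkIdeal_mono (comap_le_controlledTransform (blowup.π C) C T.ideal m) _
  have h3 : stalkIdeal (T.ideal.comap (blowup.π C)) (W'.ι ⟨x, hxW'⟩) = ⊥ := h2
  rw [h3, Ideal.map_bot]

/-- **One admissible blow-up of a triple satisfies the conditions of Notation 3.64 again**
(the step of Def. 3.66: `(X_{i+1}, I_{i+1}, m, E_{i+1}) = (B_{Z_i} X_i, (π_i)_*^{-1}(I_i, m),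
(π_i)_tot^{-1} E_i)`), except for the bookkeeping of repeated members of the boundary, which is
treated separately: the blown-up scheme is regular and equidimensional of dimension `n`, the
transformed ideal (`MarkedIdeal.transform`: controlled transform) has no vanishing stalk, and
the transformed boundary (strict transforms followed by the exceptional divisor) has simple
normal crossings (`MarkedIdeal.hasSNC_transform_boundary`, Kollár Def. 3.25).
[cite: Kollar2007, Notation 3.64 (p. 148) with Def. 3.66 (p. 149) and Def. 3.25 (p. 126)] -/
theorem transform_conditions (hm : 1 ≤ m) (hC : (C.support : Set T.X) ⊆ (T.marked m).support)
    (hsnc : HasSNCWith T.boundary C) (hCreg : Scheme.IsRegular C.subscheme) :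
    Scheme.IsRegular (blowup C) ∧
      (∀ S ∈ irreducibleComponents (blowup C), topologicalKrullDim S = n) ∧
      (∀ x : blowup C, stalkIdeal ((T.marked m).transform (blowup.π C) C).ideal x ≠ ⊥) ∧
      HasSNC ((T.marked m).transform (blowup.π C) C).boundary :=
  ⟨T.isRegular_blowup hCreg, T.equidim_blowup hm hC hCreg,
    fun x => by simpa using T.stalkIdeal_controlledTransform_ne_bot hm hC hCreg x,
    MarkedIdeal.hasSNC_transform_boundary (T.marked m) hsnc (blowup.isBlowup C)⟩

end Blowup

end Kollar2007.Triple

end Literature.AlgebraicGeometry.Resolution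

end
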